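import Literature.ModelTheory.ExponentialFields.DefinableAlgebraicNumbers
import Literature.NumberTheory.Transcendental.GammaIsoCross
import Literature.NumberTheory.Transcendental.StandardKernelBaseIso
import Literature.NumberTheory.Transcendental.GammaFieldsEcl
import Literature.NumberTheory.Transcendental.GammaIsoTransfer
import Literature.NumberTheory.Transcendental.ZilberFieldSaturationMain
import Literature.NumberTheory.Transcendental.SchanuelEclEmptyProofs
import Literature.NumberTheory.Transcendental.ZilberFieldAutomorphisms
import Literature.NumberTheory.Transcendental.ZilberFieldAutomorphismsUncountable
import HarnessLib

/-!
# Discharging `KMO2012_automorphismExtension`: the KMO automorphism-extension Proposition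

Second sibling proofs file of `Literature/ModelTheory/ExponentialFields/DefinableAlgebraicNumbers.lean`
(the first, `DefinableAlgebraicNumbersProofs.lean`, deduces `KMO2012_exists_equiv_apply_ne` from the
Proposition), for the named fact `Literature.ModelTheory.ExponentialFields.KMO2012_automorphismExtension`
(J. Kirby, A. Macintyre, A. Onshuus, *The algebraic numbers definable in various exponential
fields*, J. Inst. Math. Jussieu 11 (2012), §3.5, Proposition: in a Zilber field with CCP, every
automorphism of a finitely generated partial E-subfield `F₀ ◁ F` containing `SK` extends to an
automorphism of `F`; printed proof: "quasiminimal excellence of the class of Zilber fields and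
Theorem 3.3 in [K3]" = J. Kirby, *On quasiminimal excellent classes*, JSL 75 (2010)).

This file TRANSLATES the hypotheses of the fact (an intermediate field `F₀`, a `ℚ`-subspace `D`
with `exp D ⊆ F₀ ⊇ D ⊇ ker exp`, a finite generating set `X`, the strong-embedding inequality
`td(Y, exp Y/F₀) ≥ ldim_ℚ(Y/D)` stated with `Algebra.trdeg`, and a field automorphism `σ` of `F₀`
respecting `D` and `exp|_D`) into the Γ-field vocabulary of the tree's proof of Zilber's
categoricity theorem (`GammaFields.lean`, `GammaIsoCross.lean`): the span `ℚX` is a strong subspace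
containing the kernel (`isStrong_span_of_kmoStrong`), `σ` moves the kernel generator `τ` to `±τ`
(`coe_apply_kernelGenerator_eq_or_eq_neg`), and `c ↦ σ c` (for a suitable enumeration `c` of `X`)
is a cross Γ-isomorphism over the induced isomorphism `σ₀ : ℚ^{ab}(τ) ≅ ℚ^{ab}(σ τ)` of base
Γ-fields (`isGammaIsoTw₂_of_kmo`); whence the Proposition follows from any "Γ-form" automorphism
extension principle for the field (`kmo_of_gammaForm`), in particular for countable Zilber fields
(`ZilberAutomorphisms.exists_equiv_of_isGammaIsoTw₂_of_countable`, Kirby 2010 Thm 2.1 / Prop. 2.3)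
and — through Kirby's Thm 3.3 in the class `ZilberClosedClassOver (ecl ∅)` of the tree's proof of
Zilber's categoricity theorem (`ZilberFieldAutomorphismsUncountable.lean`) — for all Zilber fields in
`Type`: `KMO2012_automorphismExtension_of_type_zero : KMO2012_automorphismExtension.{0}`.

## References

* J. Kirby, A. Macintyre, A. Onshuus, J. Inst. Math. Jussieu 11 (2012) 825–834, arXiv:1101.4224:
  §3.1 (partial E-fields), §3.2 (strong embeddings), §3.5 Proposition.
* J. Kirby, *On quasiminimal excellent classes*, J. Symbolic Logic 75 (2010) 551–564: Thm 2.1,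
  Prop. 2.3, Thm 3.3.
* M. Bays, J. Kirby, Algebra & Number Theory 12 (2018) 493–549: Def. 3.10, Def. 4.3, Lemma 8.3.
-/

noncomputable section

open Set

universe u

namespace Literature.ModelTheory.ExponentialFields

open Literature.NumberTheory.Transcendental Literature.NumberTheory.Transcendental.GammaField
  Literature.NumberTheory.Transcendental.ZilberSaturationMain
  Literature.ModelTheory.ExponentialFields.ExponentialRing

namespace KMO2012

variable {F : Type u} [Field F] [CharZero F] [ExponentialRing F]
variable {F₀ : IntermediateField ℚ F} {D : Submodule ℚ F}

/-! ### Automorphisms of a finitely generated partial E-field: the inverse is again one -/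

omit [ExponentialRing F] in
/-- **An automorphism of a partial E-field with finite-dimensional domain maps the domain ONTO
itself** (Kirby–Macintyre–Onshuus 2012, §3.1: embeddings of partial exponential fields; for a
field automorphism `σ` of `F₀` with `σ(D) ⊆ D` and `D` finite dimensional, `σ(D) = D`, so
`σ⁻¹(D) ⊆ D`). [cite: KirbyMacintyreOnshuus2012, §3.1] -/
theorem coe_symm_apply_mem [Module.Finite ℚ D] (σ : F₀ ≃+* F₀)
    (hσD : ∀ x : F₀, (x : F) ∈ D → (σ x : F) ∈ D) (x : F₀) (hx : (x : F) ∈ D) :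
    ((σ.symm x : F₀) : F) ∈ D := by
  -- `D` seen inside `F₀`
  let D' : Submodule ℚ F₀ := D.comap (F₀.val.toLinearMap)
  have hmem : ∀ {y : F₀}, y ∈ D' ↔ (y : F) ∈ D := fun {y} => Submodule.mem_comap
  -- it is finite dimensional
  let f : D' →ₗ[ℚ] D := (F₀.val.toLinearMap).restrict fun y hy => (hmem.1 hy)
  have hf : Function.Injective f := by
    intro a b hab
    apply Subtype.ext
    apply Subtype.ext
    have := congrArg Subtype.val hab
    exact this
  haveI : Module.Finite ℚ D' := Module.Finite.of_injective f hf
  -- `σ` restricts to an injective, hence surjective, endomorphism of `D'`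
  let σℓ : F₀ →ₗ[ℚ] F₀ := σ.toAddMonoidHom.toRatLinearMap
  have hσℓ : ∀ y, σℓ y = σ y := fun _ => rfl
  let g : D' →ₗ[ℚ] D' := σℓ.restrict fun y hy => hmem.2 (by rw [hσℓ]; exact hσD y (hmem.1 hy))
  have hg : Function.Injective g := by
    intro a b hab
    apply Subtype.ext
    have := congrArg Subtype.val hab
    exact σ.injective this
  have hsurj : Function.Surjective g := LinearMap.surjective_of_injective hg
  obtain ⟨y, hy⟩ := hsurj ⟨x, hmem.2 hx⟩
  have hyx : σ (y : F₀) = x := congrArg Subtype.val hy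
  have : σ.symm x = y := by rw [← hyx, RingEquiv.symm_apply_apply]
  rw [this]
  exact hmem.1 y.2

/-- **The inverse automorphism also commutes with `exp` on the domain** (KMO 2012, §3.1).
[cite: KirbyMacintyreOnshuus2012, §3.1] -/
theorem exp_coe_symm_apply [Module.Finite ℚ D]
    (hexpF₀ : ∀ x ∈ D, exp x ∈ F₀) (σ : F₀ ≃+* F₀)
    (hσD : ∀ x : F₀, (x : F) ∈ D → (σ x : F) ∈ D)
    (hσexp : ∀ x y : F₀, (x : F) ∈ D → exp (x : F) = y → exp (σ x : F) = σ y)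
    (x : F₀) (hx : (x : F) ∈ D) :
    exp ((σ.symm x : F₀) : F) = ((σ.symm ⟨exp (x : F), hexpF₀ _ hx⟩ : F₀) : F) := by
  have hy : ((σ.symm x : F₀) : F) ∈ D := coe_symm_apply_mem σ hσD x hx
  have h1 := hσexp (σ.symm x) ⟨exp ((σ.symm x : F₀) : F), hexpF₀ _ hy⟩ hy rfl
  rw [RingEquiv.apply_symm_apply] at h1
  -- `exp x = σ (exp (σ⁻¹ x))`
  have h2 : (⟨exp (x : F), hexpF₀ _ hx⟩ : F₀) = σ ⟨exp ((σ.symm x : F₀) : F), hexpF₀ _ hy⟩ :=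
    Subtype.ext h1
  rw [h2, RingEquiv.symm_apply_apply]

/-- **An automorphism of a partial E-field containing the standard kernel moves the kernel
generator `τ` to `±τ`** (KMO 2012, §3.2: the embedding of `SK` "is unique modulo sending `2πi` to
either `τ` or `-τ`"): `σ τ` and `σ⁻¹ τ` generate subgroups of `ker exp = τℤ` whose product of
indices is `1`. [cite: KirbyMacintyreOnshuus2012, §3.2] -/
theorem coe_apply_kernelGenerator_eq_or_eq_neg [Module.Finite ℚ D] (hDF₀ : (D : Set F) ⊆ F₀)
    (hexpF₀ : ∀ x ∈ D, exp x ∈ F₀) {τ : F} (hker : expKernel F = AddSubgroup.zmultiples τ)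
    (hτ : τ ≠ 0) (hτD : τ ∈ D) (σ : F₀ ≃+* F₀)
    (hσD : ∀ x : F₀, (x : F) ∈ D → (σ x : F) ∈ D)
    (hσexp : ∀ x y : F₀, (x : F) ∈ D → exp (x : F) = y → exp (σ x : F) = σ y) :
    ((σ ⟨τ, hDF₀ hτD⟩ : F₀) : F) = τ ∨ ((σ ⟨τ, hDF₀ hτD⟩ : F₀) : F) = -τ := by
  set τ₀ : F₀ := ⟨τ, hDF₀ hτD⟩ with hτ₀
  have hτker : exp τ = 1 := by
    rw [← mem_expKernel_iff, hker]; exact AddSubgroup.mem_zmultiples τ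
  -- `σ τ ∈ ker exp`
  have h1 : exp ((σ τ₀ : F₀) : F) = 1 := by
    have := hσexp τ₀ 1 hτD (by rw [hτ₀]; exact_mod_cast hτker)
    rw [this, map_one]; rfl
  -- `σ⁻¹ τ ∈ ker exp`
  have h2 : exp ((σ.symm τ₀ : F₀) : F) = 1 := by
    rw [exp_coe_symm_apply hexpF₀ σ hσD hσexp τ₀ hτD]
    have : (⟨exp ((τ₀ : F₀) : F), hexpF₀ _ hτD⟩ : F₀) = 1 := by
      apply Subtype.ext
      show exp τ = ((1 : F₀) : F)
      rw [hτker]; rfl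
    rw [this, map_one]; rfl
  have hmem : ∀ {z : F}, exp z = 1 → ∃ k : ℤ, k • τ = z := fun {z} hz => by
    rw [← AddSubgroup.mem_zmultiples_iff, ← hker, mem_expKernel_iff]; exact hz
  obtain ⟨k, hk⟩ := hmem h1
  obtain ⟨k', hk'⟩ := hmem h2
  -- `σ (σ⁻¹ τ) = τ` gives `k' k = 1`
  have hk'F₀ : (σ.symm τ₀ : F₀) = k' • τ₀ := Subtype.ext (by
    rw [← hk']; simp [hτ₀, zsmul_eq_mul])
  have hprod : (k' * k) • τ = τ := by
    have h3 : σ (σ.symm τ₀) = τ₀ := σ.apply_symm_apply τ₀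
    rw [hk'F₀, map_zsmul] at h3
    have h4 := congrArg Subtype.val h3
    change k' • ((σ τ₀ : F₀) : F) = τ at h4
    rw [← hk, smul_smul] at h4
    exact h4
  have hunit : k' * k = 1 := by
    rw [zsmul_eq_mul] at hprod
    have h5 : ((k' * k : ℤ) : F) = 1 := mul_right_cancel₀ hτ (hprod.trans (one_mul τ).symm)
    exact_mod_cast h5
  rcases Int.eq_one_or_neg_one_of_mul_eq_one' hunit with ⟨-, rfl⟩ | ⟨-, rfl⟩
  · left; rw [← hk, one_zsmul]
  · right; rw [← hk, neg_one_zsmul]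

/-! ### The span of the generators is a strong subspace -/

/-- `exp` of a `ℚ`-linear combination of elements whose exponentials are algebraic over `s` is
algebraic over `s` (`exp (∑ qᵢ tᵢ) = ∏ exp(tᵢ)^{qᵢ}`). [folklore] -/
theorem exp_mem_acl_of_mem_span {T s : Set F} (hT : ∀ x ∈ T, exp x ∈ acl s) {y : F}
    (hy : y ∈ Submodule.span ℚ T) : exp y ∈ acl s := by
  induction hy using Submodule.span_induction with
  | mem x hx => exact hT x hx
  | zero => rw [ExponentialRing.exp_zero]; exact one_mem_acl s
  | add x y _ _ hx hy => rw [ExponentialRing.exp_add]; exact mul_mem_acl hx hy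
  | smul q x _ hx => exact exp_smul_mem_acl q hx

/-- **The exponentials of the generators have rank at most `ldim_ℚ(X'/D)` over `F₀`** when
`exp D ⊆ F₀`: writing `x = d + ∑ qⱼ wⱼ` (`d ∈ D`, `w` a basis of `ℚX'` modulo `D`),
`exp x = exp d · ∏ exp(wⱼ)^{qⱼ}` is algebraic over `F₀ ∪ {exp wⱼ}`.
[cite: KirbyMacintyreOnshuus2012, §3.1–3.2] -/
theorem relRank_exp_image_le_ldim (hexpF₀ : ∀ x ∈ D, exp x ∈ F₀) (X' : Finset F) :
    (algMatroid F).relRank (F₀ : Set F) (exp '' (X' : Set F)) ≤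
      ldim D (Submodule.span ℚ (X' : Set F)) := by
  classical
  set xt : Fin X'.card → F := fun i => (X'.equivFin.symm i : F) with hxt
  have hrange : range xt = (X' : Set F) := by
    ext x
    constructor
    · rintro ⟨i, rfl⟩; exact (X'.equivFin.symm i).2
    · intro hx; exact ⟨X'.equivFin ⟨x, hx⟩, by simp [hxt]⟩
  obtain ⟨k₀, ρ, hw, hspan⟩ := exists_linIndepOver_comp D xt
  have hk : ldim D (Submodule.span ℚ (X' : Set F)) = k₀ := by
    rw [← ldim_sup_left, ← hrange, ← hspan, ldim_sup_left, ldim_span_eq_of_linIndepOver hw]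
  -- every `exp x`, `x ∈ X'`, is algebraic over `F₀ ∪ exp w`
  have hsub : exp '' (X' : Set F) ⊆
      (algMatroid F).closure (exp '' range (xt ∘ ρ) ∪ (F₀ : Set F)) := by
    rintro _ ⟨x, hx, rfl⟩
    have hx' : x ∈ D ⊔ Submodule.span ℚ (range (xt ∘ ρ)) := by
      rw [hspan, hrange]; exact Submodule.mem_sup_right (Submodule.subset_span hx)
    obtain ⟨dd, hdd, y, hy, rfl⟩ := Submodule.mem_sup.1 hx'
    show exp (dd + y) ∈ acl _
    rw [ExponentialRing.exp_add]
    refine mul_mem_acl (subset_acl _ (Or.inr (hexpF₀ dd hdd))) ?_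
    refine exp_mem_acl_of_mem_span ?_ hy
    intro z hz
    exact subset_acl _ (Or.inl (mem_image_of_mem _ hz))
  have hcard : (range (xt ∘ ρ)).encard ≤ k₀ := by
    rw [← image_univ]
    refine (encard_image_le _ _).trans ?_
    rw [encard_univ]
    simp [ENat.card_eq_coe_fintype_card]
  calc (algMatroid F).relRank (F₀ : Set F) (exp '' (X' : Set F))
      ≤ (algMatroid F).relRank (F₀ : Set F) (exp '' range (xt ∘ ρ)) :=
        (algMatroid F).relRank_le_of_subset_closure _ hsub
    _ ≤ ((exp '' range (xt ∘ ρ)) \ (F₀ : Set F)).encard := (algMatroid F).relRank_le_encard_diff _ _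
    _ ≤ (exp '' range (xt ∘ ρ)).encard := encard_le_encard fun z hz => hz.1
    _ ≤ (range (xt ∘ ρ)).encard := encard_image_le _ _
    _ ≤ k₀ := hcard
    _ = ldim D (Submodule.span ℚ (X' : Set F)) := by rw [hk]

/-- **Strong embedding, KMO's form ⟹ Bays–Kirby's form for the span of the generators**
(Kirby–Macintyre–Onshuus 2012, §3.2: `F₀ ◁ F` iff `td(Y, exp Y/F₀) ≥ ldim_ℚ(Y/D(F₀))` for all
finite `Y`; Bays–Kirby 2018, Def. 4.3: `δ(Λ'/Λ) ≥ 0` for all finitely generated `Λ' ⊇ Λ`). If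
`exp D ⊆ F₀`, `X' ⊆ F₀` is finite and `D ≤ ℚX'`, then KMO-strongness of `(F₀, D)` in `F` makes the
subspace `ℚX'` strong in `F`: for finite `s`, apply the hypothesis to `Y = s ∪ X'` and split
`ldim_ℚ((s ∪ X')/D) = ldim_ℚ(X'/D) + ldim_ℚ(s/ℚX')` and `td(s, X', exp s, exp X'/F₀) =
td(exp X'/F₀) + td(s, exp s/F₀(exp X'))`, where `td(exp X'/F₀) ≤ ldim_ℚ(X'/D)`
(`relRank_exp_image_le_ldim`) and the Γ-field of `ℚX'` is algebraic over `F₀(exp X')`.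
[cite: KirbyMacintyreOnshuus2012, §3.2] [cite: BaysKirby2018ANT, Def. 4.3] -/
theorem isStrong_span_of_kmoStrong (hexpF₀ : ∀ x ∈ D, exp x ∈ F₀)
    (hstrong : ∀ Y : Finset F,
        (Module.finrank ℚ ↥((Submodule.span ℚ (Y : Set F)).map D.mkQ) : Cardinal) ≤
          Algebra.trdeg F₀ ↥(IntermediateField.adjoin F₀ ((Y : Set F) ∪ exp '' (Y : Set F))))
    {X' : Finset F} (hX'F₀ : (X' : Set F) ⊆ F₀) (hDX' : D ≤ Submodule.span ℚ (X' : Set F)) :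
    IsStrong (Submodule.span ℚ (X' : Set F)) := by
  classical
  set A := Submodule.span ℚ (X' : Set F) with hA
  set M := algMatroid F with hM
  set L₀ : Set F := (F₀ : Set F) with hL₀
  have hAF₀ : ∀ z ∈ A, z ∈ F₀ := fun z hz =>
    (Submodule.span_le (p := Subalgebra.toSubmodule F₀.toSubalgebra)).2 hX'F₀ hz
  rw [isStrong_iff_finset]
  intro s
  set B := Submodule.span ℚ (s : Set F) with hB
  set SX : Set F := (X' : Set F) ∪ exp '' (X' : Set F) with hSX
  set Ss : Set F := (s : Set F) ∪ exp '' (s : Set F) with hSs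
  have hAB : A ⊔ B = Submodule.span ℚ ((X' : Set F) ∪ (s : Set F)) := (Submodule.span_union _ _).symm
  -- the KMO inequality for `Y = s ∪ X'`, in `ℕ∞`
  have h1 : ((ldim D (A ⊔ B) : ℕ) : ℕ∞) ≤ M.relRank L₀ (SX ∪ Ss) := by
    have h := OrderHomClass.mono Cardinal.toENat (hstrong (s ∪ X'))
    rw [map_natCast, toENat_trdeg_adjoin_eq_relRank] at h
    have hset : ((↑(s ∪ X') : Set F) ∪ exp '' (↑(s ∪ X') : Set F)) = SX ∪ Ss := by
      rw [Finset.coe_union, image_union]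
      ext z; simp only [mem_union, hSX, hSs]; tauto
    have hld : Module.finrank ℚ ↥((Submodule.span ℚ (↑(s ∪ X') : Set F)).map D.mkQ) =
        ldim D (A ⊔ B) := by
      rw [Finset.coe_union, union_comm, ← hAB]; rfl
    rwa [hset, hld] at h
  -- split the linear dimension along `D ≤ A ≤ A ⊔ B`
  have h2 : ldim D (A ⊔ B) = ldim D A + ldim A B := by
    have hfg : IsFG D (A ⊔ B) := by
      rw [hAB]; exact isFG_span_of_finite D (X'.finite_toSet.union s.finite_toSet)
    rw [ldim_add hDX' le_sup_left hfg, ldim_sup_left]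
  -- split the rank along `L₀ ⊆ L₀ ∪ SX`
  have h3 : M.relRank L₀ (SX ∪ Ss) = M.relRank L₀ SX + M.relRank (L₀ ∪ SX) Ss := by
    have := M.relRank_add_relRank' (subset_union_left : L₀ ⊆ L₀ ∪ SX) Ss
    rw [Matroid.relRank_union_self_left, union_assoc, Matroid.relRank_union_self_left] at this
    exact this.symm
  -- the first summand is at most `ldim D A`
  have h4 : M.relRank L₀ SX ≤ ldim D A := by
    have hc : M.relRank L₀ SX = M.relRank L₀ (exp '' (X' : Set F)) := by
      refine M.relRank_congr_closure L₀ ?_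
      congr 1
      rw [hSX, union_assoc, union_comm, union_assoc, union_eq_self_of_subset_right hX'F₀, union_comm]
    rw [hc]; exact relRank_exp_image_le_ldim hexpF₀ X'
  -- the second is at most `td A B`
  have h5 : M.relRank (L₀ ∪ SX) Ss ≤ td A B := by
    rw [td_def]
    have hgens : gens A ⊆ M.closure (L₀ ∪ SX) := by
      rintro z (hz | ⟨y, hy, rfl⟩)
      · exact subset_acl _ (Or.inl (hAF₀ z hz))
      · refine exp_mem_acl_of_mem_span ?_ hy
        intro x hx
        exact subset_acl _ (Or.inr (Or.inr (mem_image_of_mem _ hx)))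
    have hSsub : Ss ⊆ gens B := by
      rintro z (hz | ⟨y, hy, rfl⟩)
      · exact Or.inl (Submodule.subset_span hz)
      · exact Or.inr (mem_image_of_mem _ (Submodule.subset_span hy))
    calc M.relRank (L₀ ∪ SX) Ss ≤ M.relRank (L₀ ∪ SX) (gens B) := M.relRank_mono_right _ hSsub
      _ = M.relRank (M.closure (L₀ ∪ SX)) (gens B) := (M.relRank_closure_left _ _).symm
      _ ≤ M.relRank (gens A) (gens B) := M.relRank_anti_left _ hgens
  -- combine
  have h6 : ((ldim D A : ℕ) : ℕ∞) + ldim A B ≤ (ldim D A : ℕ∞) + td A B := by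
    calc ((ldim D A : ℕ) : ℕ∞) + (ldim A B : ℕ∞) = ((ldim D (A ⊔ B) : ℕ) : ℕ∞) := by
          rw [h2, Nat.cast_add]
      _ ≤ M.relRank L₀ (SX ∪ Ss) := h1
      _ = M.relRank L₀ SX + M.relRank (L₀ ∪ SX) Ss := h3
      _ ≤ (ldim D A : ℕ∞) + td A B := add_le_add h4 h5
  have h7 : (ldim A B : ℕ∞) ≤ td A B := (ENat.add_le_add_iff_left (ENat.coe_ne_top _)).1 h6
  -- conclude
  have hfin : td A B ≠ ⊤ := td_ne_top (isFG_span_of_finite A s.finite_toSet)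
  have h8 : ldim A B ≤ (td A B).toNat := by
    rw [← ENat.coe_le_coe, ENat.coe_toNat hfin]; exact h7
  rw [predim_def]
  have : (ldim A B : ℤ) ≤ ((td A B).toNat : ℤ) := by exact_mod_cast h8
  linarith

/-! ### The cross Γ-isomorphism defined by `σ` -/

/-- If `l : Fin n → E` generates over `K` a field of transcendence degree `≥ n`, then `l` is
algebraically independent over `K` (Mathlib's
`Algebra.IsAlgebraic.isTranscendenceBasis_of_lift_le_trdeg_of_finite`, the field `K(l)` being
algebraic over `K[l]`; the same lemma as
`Literature.Barriers.Schanuel.algebraicIndependent_of_le_trdeg_adjoin`, repeated to keep the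
import graph small). [folklore] -/
theorem algebraicIndependent_of_le_trdeg_adjoin' {K E : Type*} [Field K] [Field E] [Algebra K E]
    {n : ℕ} (l : Fin n → E)
    (h : (n : Cardinal) ≤ Algebra.trdeg K (IntermediateField.adjoin K (Set.range l))) :
    AlgebraicIndependent K l := by
  set A : IntermediateField K E := IntermediateField.adjoin K (Set.range l) with hA
  let x : Fin n → A := fun i => ⟨l i, IntermediateField.subset_adjoin K _ ⟨i, rfl⟩⟩
  haveI : Algebra.IsAlgebraic (Algebra.adjoin K (Set.range x)) A := by
    have hx : Set.range x = ((↑) : A → E) ⁻¹' Set.range l := by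
      ext a
      constructor
      · rintro ⟨i, rfl⟩; exact ⟨i, rfl⟩
      · rintro ⟨i, hi⟩; exact ⟨i, Subtype.ext hi⟩
    rw [hx]
    exact isAlgebraic_adjoin_over_algebraAdjoin _
  have hB := Algebra.IsAlgebraic.isTranscendenceBasis_of_lift_le_trdeg_of_finite K x
    (by simpa using h)
  exact hB.1.map' (f := A.val) (fun a b hab => Subtype.ext hab)

/-- **`c ↦ σ c` is a cross Γ-isomorphism over `σ₀`** (Kirby–Macintyre–Onshuus 2012, §3.1:
an isomorphism of partial E-fields; Bays–Kirby 2018, Def. 3.10, levelwise form of the tree's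
`GammaField.IsGammaIsoTw₂`). Let `σF` be a map which is an injective ring endomorphism `σr` on the
intermediate field `F₀`, agrees with the base isomorphism `σ₀ : ℚ^{ab}(τ) ≅ ℚ^{ab}(τ₂)` on
`ℚ^{ab}(τ) ≤ F₀`, and commutes with `exp` on the division points `dᵢ/M!` of a tuple `d` from `F₀`
(whose exponentials lie in `F₀`). If moreover, for a tuple `w` from `F₀`, at every level `M` both
`(exp (wⱼ/M!))ⱼ` and `(exp (σF wⱼ/M!))ⱼ` are algebraically independent over `F₀`, then
`(d, w) ↦ (σF d, σF w)` is a Γ-isomorphism over `σ₀`: a polynomial relation among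
`(d, w, exp(d/M!), exp(w/M!))` over `ℚ^{ab}(τ)` is, after evaluating the variables standing for
elements of `F₀`, a polynomial over `F₀` vanishing at the algebraically independent `exp(w/M!)`,
i.e. zero; and `σr` transports such relations. [cite: KirbyMacintyreOnshuus2012, §3.1]
[cite: BaysKirby2018ANT, Def. 3.10] -/
theorem isGammaIsoTw₂_of_kmo {τ τ₂ : F}
    {σ₀ : fieldOf (Submodule.span ℚ ({τ} : Set F)) ≃+* fieldOf (Submodule.span ℚ ({τ₂} : Set F))}
    (σF : F → F) (hle : fieldOf (Submodule.span ℚ ({τ} : Set F)) ≤ F₀)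
    (hσSK : ∀ k : fieldOf (Submodule.span ℚ ({τ} : Set F)), σF k = σ₀ k)
    (σr : F₀ →+* F₀) (hσr : ∀ y : F₀, σF y = σr y) (hσinj : Function.Injective σr)
    {a k : ℕ} {d : Fin a → F} {w : Fin k → F} (hdF₀ : ∀ i, d i ∈ F₀) (hwF₀ : ∀ j, w j ∈ F₀)
    (hdexp : ∀ (i : Fin a) (M : ℕ), exp (d i / (M.factorial : F)) ∈ F₀ ∧
      σF (exp (d i / (M.factorial : F))) = exp (σF (d i) / (M.factorial : F)))
    (hz : ∀ M : ℕ, AlgebraicIndependent F₀ fun j => exp (w j / (M.factorial : F)))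
    (hz' : ∀ M : ℕ, AlgebraicIndependent F₀ fun j => exp (σF (w j) / (M.factorial : F))) :
    IsGammaIsoTw₂ σ₀ (Fin.append d w) (σF ∘ Fin.append d w) := by
  classical
  set c : Fin (a + k) → F := Fin.append d w with hc
  let incl : fieldOf (Submodule.span ℚ ({τ} : Set F)) →+* F₀ := (IntermediateField.inclusion hle).toRingHom
  have hincl : ∀ r : fieldOf (Submodule.span ℚ ({τ} : Set F)), ((incl r : F₀) : F) = r := fun _ => rfl
  intro M P
  -- the algebraically independent blocks
  set z : Fin k → F := fun j => exp (w j / (M.factorial : F)) with hzdef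
  set z' : Fin k → F := fun j => exp (σF (w j) / (M.factorial : F)) with hz'def
  -- partial evaluation: variables standing for elements of `F₀` become constants
  let g : Fin (a + k) ⊕ Fin (a + k) → MvPolynomial (Fin k) F₀ :=
    Sum.elim (fun i => MvPolynomial.C ⟨c i, by
        refine Fin.addCases (fun i₁ => ?_) (fun j => ?_) i
        · simpa only [hc, Fin.append_left] using hdF₀ i₁
        · simpa only [hc, Fin.append_right] using hwF₀ j⟩)
      (fun i => Fin.addCases (motive := fun _ => MvPolynomial (Fin k) F₀)
        (fun i₁ => MvPolynomial.C ⟨exp (d i₁ / (M.factorial : F)), (hdexp i₁ M).1⟩)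
        (fun j => MvPolynomial.X j) i)
  let Θ : MvPolynomial (Fin (a + k) ⊕ Fin (a + k)) (fieldOf (Submodule.span ℚ ({τ} : Set F))) →+*
      MvPolynomial (Fin k) F₀ :=
    MvPolynomial.eval₂Hom (MvPolynomial.C.comp incl) g
  -- identity on the source side
  have hI1 : ∀ Q, MvPolynomial.aeval (lvGens M c) Q = MvPolynomial.aeval z (Θ Q) := by
    intro Q
    have key : (MvPolynomial.aeval (lvGens M c)).toRingHom =
        (MvPolynomial.aeval z).toRingHom.comp Θ := by
      refine MvPolynomial.ringHom_ext (fun r => ?_) (fun v => ?_)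
      · simp only [AlgHom.toRingHom_eq_coe, RingHom.coe_coe, MvPolynomial.aeval_C, RingHom.coe_comp,
          Function.comp_apply, Θ, MvPolynomial.eval₂Hom_C, MvPolynomial.aeval_C]
        rfl
      · rcases v with i | i
        · simp only [AlgHom.toRingHom_eq_coe, RingHom.coe_coe, MvPolynomial.aeval_X, lvGens_inl,
            RingHom.coe_comp, Function.comp_apply, Θ, MvPolynomial.eval₂Hom_X', g, Sum.elim_inl,
            MvPolynomial.aeval_C]
          rfl
        · simp only [AlgHom.toRingHom_eq_coe, RingHom.coe_coe, MvPolynomial.aeval_X, lvGens_inr,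
            RingHom.coe_comp, Function.comp_apply, Θ, MvPolynomial.eval₂Hom_X', g, Sum.elim_inr]
          refine Fin.addCases (fun i₁ => ?_) (fun j => ?_) i
          · simp only [Fin.addCases_left, MvPolynomial.aeval_C, hc, Fin.append_left]
            rfl
          · simp only [Fin.addCases_right, MvPolynomial.aeval_X, hc, Fin.append_right, hzdef]
    exact congrArg
      (fun f : MvPolynomial (Fin (a + k) ⊕ Fin (a + k)) (fieldOf (Submodule.span ℚ ({τ} : Set F))) →+* F =>
        f Q) key
  -- identity on the target side
  have hI2 : ∀ Q, MvPolynomial.aeval (lvGens M (σF ∘ c))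
        (MvPolynomial.map (σ₀ : fieldOf (Submodule.span ℚ ({τ} : Set F)) →+*
          fieldOf (Submodule.span ℚ ({τ₂} : Set F))) Q) =
      MvPolynomial.aeval z' (MvPolynomial.map σr (Θ Q)) := by
    intro Q
    have key : (MvPolynomial.aeval (lvGens M (σF ∘ c))).toRingHom.comp
          (MvPolynomial.map (σ₀ : fieldOf (Submodule.span ℚ ({τ} : Set F)) →+*
            fieldOf (Submodule.span ℚ ({τ₂} : Set F)))) =
        ((MvPolynomial.aeval z').toRingHom.comp (MvPolynomial.map σr)).comp Θ := by
      refine MvPolynomial.ringHom_ext (fun r => ?_) (fun v => ?_)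
      · simp only [AlgHom.toRingHom_eq_coe, RingHom.coe_comp, RingHom.coe_coe, Function.comp_apply,
          MvPolynomial.map_C, MvPolynomial.aeval_C, Θ, MvPolynomial.eval₂Hom_C]
        change ((σ₀ r : fieldOf (Submodule.span ℚ ({τ₂} : Set F))) : F) = ((σr (incl r) : F₀) : F)
        rw [← hσSK r, ← hσr (incl r), hincl]
      · rcases v with i | i
        · simp only [AlgHom.toRingHom_eq_coe, RingHom.coe_comp, RingHom.coe_coe, Function.comp_apply,
            MvPolynomial.map_X, MvPolynomial.aeval_X, lvGens_inl, Θ, MvPolynomial.eval₂Hom_X', g,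
            Sum.elim_inl, MvPolynomial.map_C, MvPolynomial.aeval_C]
          change σF (c i) = ((σr _ : F₀) : F)
          rw [← hσr]
        · simp only [AlgHom.toRingHom_eq_coe, RingHom.coe_comp, RingHom.coe_coe, Function.comp_apply,
            MvPolynomial.map_X, MvPolynomial.aeval_X, lvGens_inr, Θ, MvPolynomial.eval₂Hom_X', g,
            Sum.elim_inr]
          refine Fin.addCases (fun i₁ => ?_) (fun j => ?_) i
          · simp only [Fin.addCases_left, MvPolynomial.map_C, MvPolynomial.aeval_C, hc,
              Fin.append_left]
            change exp (σF (d i₁) / (M.factorial : F)) = ((σr _ : F₀) : F)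
            rw [← hσr]
            exact (hdexp i₁ M).2.symm
          · simp only [Fin.addCases_right, MvPolynomial.map_X, MvPolynomial.aeval_X, hc,
              Fin.append_right, hz'def]
    exact congrArg
      (fun f : MvPolynomial (Fin (a + k) ⊕ Fin (a + k)) (fieldOf (Submodule.span ℚ ({τ} : Set F))) →+* F =>
        f Q) key
  -- conclusion
  rw [hI1 P, hI2 P]
  constructor
  · intro h0
    have hΘ : Θ P = 0 := algebraicIndependent_iff.1 (hz M) _ h0
    rw [hΘ, map_zero, map_zero]
  · intro h0
    have hΘ' : MvPolynomial.map σr (Θ P) = 0 := algebraicIndependent_iff.1 (hz' M) _ h0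
    have hΘ : Θ P = 0 := by
      apply MvPolynomial.map_injective σr hσinj
      rw [hΘ', map_zero]
    rw [hΘ, map_zero]

/-! ### Algebraic independence of division points from KMO-strongness -/

/-- **Division points of elements independent modulo `D` have algebraically independent
exponentials over `F₀`**: if `w₁, …, w_k ∈ F₀` are `ℚ`-linearly independent modulo `D` and
`(F₀, D)` is strongly embedded in KMO's sense, then for every `M` the elements `exp (wⱼ/M!)` are
algebraically independent over `F₀` (apply the strong-embedding inequality to `Y = {wⱼ/M!}`:
`td(exp Y/F₀) ≥ ldim_ℚ(Y/D) = k`). [cite: KirbyMacintyreOnshuus2012, §3.2] -/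
theorem algebraicIndependent_exp_div_of_kmoStrong
    (hstrong : ∀ Y : Finset F,
        (Module.finrank ℚ ↥((Submodule.span ℚ (Y : Set F)).map D.mkQ) : Cardinal) ≤
          Algebra.trdeg F₀ ↥(IntermediateField.adjoin F₀ ((Y : Set F) ∪ exp '' (Y : Set F))))
    {k : ℕ} {w : Fin k → F} (hwF₀ : ∀ j, w j ∈ F₀) (hw : LinIndepOver D w) (M : ℕ) :
    AlgebraicIndependent F₀ fun j => exp (w j / (M.factorial : F)) := by
  classical
  set wM : Fin k → F := fun j => w j / (M.factorial : F) with hwM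
  set zM : Fin k → F := fun j => exp (w j / (M.factorial : F)) with hzM
  have hM0 : (M.factorial : ℚ) ≠ 0 := by exact_mod_cast M.factorial_ne_zero
  -- `w/M!` is still independent modulo `D`
  have hwMind : LinIndepOver D wM := by
    intro q hq
    have h1 : ∑ j, (q j / (M.factorial : ℚ)) • w j ∈ D := by
      have : ∑ j, (q j / (M.factorial : ℚ)) • w j = ∑ j, q j • wM j := by
        refine Finset.sum_congr rfl fun j _ => ?_
        show (q j / (M.factorial : ℚ)) • w j = q j • (w j / (M.factorial : F))
        rw [div_natCast_eq_smul (w j) M.factorial, smul_smul, div_eq_mul_inv]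
      rw [this]; exact hq
    have h2 := hw _ h1
    funext j
    have := congrFun h2 j
    simp only [Pi.zero_apply, div_eq_zero_iff, hM0, or_false] at this
    exact this
  -- the finite set `Y = {wⱼ/M!}`
  set Y : Finset F := Finset.univ.image wM with hYdef
  have hY : (Y : Set F) = range wM := by
    rw [hYdef, Finset.coe_image, Finset.coe_univ, image_univ]
  have hYF₀ : ∀ y ∈ (Y : Set F), y ∈ F₀ := by
    rw [hY]; rintro _ ⟨j, rfl⟩; exact div_mem (hwF₀ j) (natCast_mem F₀ _)
  -- `ldim_ℚ(Y/D) = k`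
  have hld : Module.finrank ℚ ↥((Submodule.span ℚ (Y : Set F)).map D.mkQ) = k := by
    rw [hY]; exact ldim_span_eq_of_linIndepOver hwMind
  -- `F₀(Y, exp Y) = F₀(exp Y)`
  have hadj : IntermediateField.adjoin F₀ ((Y : Set F) ∪ exp '' (Y : Set F)) =
      IntermediateField.adjoin F₀ (range zM) := by
    refine le_antisymm ?_ (IntermediateField.adjoin.mono _ _ _ ?_)
    · rw [IntermediateField.adjoin_le_iff]
      rintro y (hy | ⟨x, hx, rfl⟩)
      · exact (IntermediateField.adjoin F₀ (range zM)).algebraMap_mem ⟨y, hYF₀ y hy⟩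
      · rw [hY] at hx
        obtain ⟨j, rfl⟩ := hx
        exact IntermediateField.subset_adjoin F₀ _ ⟨j, rfl⟩
    · rintro _ ⟨j, rfl⟩
      refine Or.inr ⟨wM j, ?_, rfl⟩
      rw [hY]; exact ⟨j, rfl⟩
  have h := hstrong Y
  rw [hld, hadj] at h
  exact algebraicIndependent_of_le_trdeg_adjoin' zM h

/-! ### The Proposition from an automorphism-extension principle in Γ-form -/

omit [ExponentialRing F] in
/-- The total extension of `σ` maps `ℚ`-spans of subsets of `F₀` to the spans of their images.
[folklore] -/
theorem sigmaF_mem_span_image (σ : F₀ ≃+* F₀) {σF : F → F} (hσF : ∀ y : F₀, σF y = σ y)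
    {T : Set F} (hT : T ⊆ F₀) {y : F} (hy : y ∈ Submodule.span ℚ T) :
    σF y ∈ Submodule.span ℚ (σF '' T) := by
  have hTF₀ : ∀ z ∈ Submodule.span ℚ T, z ∈ F₀ := fun z hz =>
    (Submodule.span_le (p := Subalgebra.toSubmodule F₀.toSubalgebra)).2 hT hz
  induction hy using Submodule.span_induction with
  | mem x hx => exact Submodule.subset_span (mem_image_of_mem _ hx)
  | zero =>
    have := hσF 0
    rw [map_zero] at this
    rw [show σF 0 = 0 from this]; exact Submodule.zero_mem _
  | add x y hx hy ihx ihy =>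
    have h := hσF (⟨x, hTF₀ x hx⟩ + ⟨y, hTF₀ y hy⟩)
    rw [map_add] at h
    have : σF (x + y) = σF x + σF y := by
      rw [hσF ⟨x, hTF₀ x hx⟩, hσF ⟨y, hTF₀ y hy⟩]; exact_mod_cast h
    rw [this]; exact Submodule.add_mem _ ihx ihy
  | smul q x hx ihx =>
    have h := hσF (q • ⟨x, hTF₀ x hx⟩)
    rw [map_rat_smul] at h
    have : σF (q • x) = q • σF x := by
      rw [hσF ⟨x, hTF₀ x hx⟩]; exact_mod_cast h
    rw [this]; exact Submodule.smul_mem _ q ihx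

set_option maxHeartbeats 800000 in
/-- **The KMO Proposition for a field, from an automorphism-extension principle in Γ-form.**
Let `F` be a Zilber field satisfying: *for kernel generators `τ₁, τ₂`, an isomorphism
`σ₀ : ℚ^{ab}(τ₁) ≅ ℚ^{ab}(τ₂)` of base Γ-fields and a cross Γ-isomorphism `c ↦ c'` over `σ₀` with
`ℚτ₁ + ℚc ◁ F`, `ℚτ₂ + ℚc' ◁ F`, some automorphism of the exponential field `F` maps `c ↦ c'` and
is `σ₀` on `ℚ^{ab}(τ₁)`* (`hmain`; for countable `F` this is
`ZilberAutomorphisms.exists_equiv_of_isGammaIsoTw₂_of_countable`, Kirby 2010 Thm 2.1 / Prop. 2.3;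
in general Kirby 2010 Thm 3.3). Then the Proposition of Kirby–Macintyre–Onshuus 2012, §3.5 holds
for `F` in the rendering of `KMO2012_automorphismExtension`: every automorphism `σ` of a finitely
generated, strongly embedded partial E-subfield `(F₀, D)` of `F` containing `SK` extends to an
automorphism of `F`. Translation: `ker exp = τℤ ⊆ D`; `σ τ = ±τ`
(`coe_apply_kernelGenerator_eq_or_eq_neg`) is again a kernel generator `τ₂`, giving `σ₀`
(`GammaField.exists_isEBaseIso₂_of_expKernel`), which agrees with `σ` on `ℚ^{ab}(τ) ⊆ F₀`; for the
enumeration `c = (d, w)` of `(X ∩ D) ∪ W`, `W ⊆ X` a basis of `ℚX` modulo `D`, the spans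
`ℚτ + ℚc = ℚX` and `ℚτ₂ + ℚσc = ℚσX` are strong (`isStrong_span_of_kmoStrong`) and `c ↦ σ c` is a
cross Γ-isomorphism over `σ₀` (`isGammaIsoTw₂_of_kmo`, `algebraicIndependent_exp_div_of_kmoStrong`);
the automorphism provided by `hmain` agrees with `σ` on `X ∪ exp D`, hence on
`F₀ = ℚ(X ∪ exp D)`. [cite: KirbyMacintyreOnshuus2012, §3.5 Proposition]
[cite: Kirby2010QMEC, Thm 2.1, Prop. 2.3 and Thm 3.3] -/
theorem kmo_of_gammaForm (hF : IsZilberField F)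
    (hmain : ∀ {τ₁ τ₂ : F}, expKernel F = AddSubgroup.zmultiples τ₁ →
      expKernel F = AddSubgroup.zmultiples τ₂ → τ₁ ≠ 0 → τ₂ ≠ 0 →
      ∀ {σ₀ : fieldOf (Submodule.span ℚ ({τ₁} : Set F)) ≃+* fieldOf (Submodule.span ℚ ({τ₂} : Set F))},
        IsEBaseIso₂ (Submodule.span ℚ ({τ₁} : Set F)) (Submodule.span ℚ ({τ₂} : Set F)) σ₀ →
      ∀ {N : ℕ} {c c' : Fin N → F}, IsGammaIsoTw₂ σ₀ c c' →
        IsStrong (Submodule.span ℚ {τ₁} ⊔ Submodule.span ℚ (range c)) →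
        IsStrong (Submodule.span ℚ {τ₂} ⊔ Submodule.span ℚ (range c')) →
        ∃ ρ : ExponentialRingEquiv F F, (∀ j, ρ (c j) = c' j) ∧
          ∀ k : fieldOf (Submodule.span ℚ ({τ₁} : Set F)), ρ k = σ₀ k)
    (F₀ : IntermediateField ℚ F) (D : Submodule ℚ F)
    (hDF₀ : (D : Set F) ⊆ F₀) (hexpF₀ : ∀ x ∈ D, exp x ∈ F₀)
    (hkerD : ∀ x : F, exp x = 1 → x ∈ D)
    (hfg : ∃ X : Finset F, Submodule.span ℚ ((X : Set F) ∩ (D : Set F)) = D ∧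
      IntermediateField.adjoin ℚ ((X : Set F) ∪ exp '' (D : Set F)) = F₀)
    (hstrong : ∀ Y : Finset F,
        (Module.finrank ℚ ↥((Submodule.span ℚ (Y : Set F)).map D.mkQ) : Cardinal) ≤
          Algebra.trdeg F₀ ↥(IntermediateField.adjoin F₀ ((Y : Set F) ∪ exp '' (Y : Set F))))
    (σ : F₀ ≃+* F₀) (hσD : ∀ x : F₀, (x : F) ∈ D → (σ x : F) ∈ D)
    (hσexp : ∀ x y : F₀, (x : F) ∈ D → exp (x : F) = y → exp (σ x : F) = σ y) :
    ∃ σ' : ExponentialRingEquiv F F, ∀ x : F₀, σ' x = σ x := by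
  classical
  obtain ⟨X, hXD, hXF₀⟩ := hfg
  haveI : Module.Finite ℚ D := by
    rw [← hXD]; exact Module.Finite.span_of_finite ℚ (X.finite_toSet.inter_of_left _)
  -- the kernel generator
  obtain ⟨τ, hτt, hker⟩ := hF.hasStandardKernel
  have hτ0 : τ ≠ 0 := fun h => hτt (h ▸ isAlgebraic_zero)
  have hexpτ : exp τ = 1 := by
    rw [← mem_expKernel_iff, hker]; exact AddSubgroup.mem_zmultiples τ
  have hτD : τ ∈ D := hkerD τ hexpτ
  have hτF₀ : τ ∈ F₀ := hDF₀ hτD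
  have hKD : Submodule.span ℚ ({τ} : Set F) ≤ D := (Submodule.span_singleton_le_iff_mem _ _).2 hτD
  -- the total extension of `σ`
  let σF : F → F := fun y => if hy : y ∈ F₀ then ((σ ⟨y, hy⟩ : F₀) : F) else 0
  have hσF : ∀ y : F₀, σF y = σ y := fun y => by simp only [σF, dif_pos y.2]
  have hσFmem : ∀ y ∈ F₀, σF y ∈ F₀ := fun y hy => by rw [hσF ⟨y, hy⟩]; exact (σ ⟨y, hy⟩).2
  have hσFadd : ∀ y z, y ∈ F₀ → z ∈ F₀ → σF (y + z) = σF y + σF z := by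
    intro y z hy hz
    have h := hσF (⟨y, hy⟩ + ⟨z, hz⟩)
    rw [map_add] at h
    rw [hσF ⟨y, hy⟩, hσF ⟨z, hz⟩]; exact_mod_cast h
  have hσFsmul : ∀ (q : ℚ) y, y ∈ F₀ → σF (q • y) = q • σF y := by
    intro q y hy
    have h := hσF (q • ⟨y, hy⟩)
    rw [map_rat_smul] at h
    rw [hσF ⟨y, hy⟩]; exact_mod_cast h
  have hσFdiv : ∀ y (M : ℕ), y ∈ F₀ → σF (y / (M.factorial : F)) = σF y / (M.factorial : F) := by
    intro y M hy
    have h := hσF (⟨y, hy⟩ / (M.factorial : F₀))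
    rw [map_div₀, map_natCast] at h
    rw [hσF ⟨y, hy⟩]; exact_mod_cast h
  have hσFexp : ∀ x ∈ D, σF (exp x) = exp (σF x) := by
    intro x hx
    have h := hσexp ⟨x, hDF₀ hx⟩ ⟨exp x, hexpF₀ x hx⟩ hx rfl
    rw [hσF ⟨x, hDF₀ hx⟩, hσF ⟨exp x, hexpF₀ x hx⟩]; exact h.symm
  have hσFD : ∀ x ∈ D, σF x ∈ D := fun x hx => by rw [hσF ⟨x, hDF₀ hx⟩]; exact hσD _ hx
  -- `σ τ = ±τ` is again a kernel generator
  set τ₂ : F := σF τ with hτ₂def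
  have hτ₂ : τ₂ = τ ∨ τ₂ = -τ := by
    have := coe_apply_kernelGenerator_eq_or_eq_neg hDF₀ hexpF₀ hker hτ0 hτD σ hσD hσexp
    rwa [← hσF ⟨τ, hDF₀ hτD⟩] at this
  have hker₂ : expKernel F = AddSubgroup.zmultiples τ₂ := by
    rcases hτ₂ with h | h
    · rw [h]; exact hker
    · rw [h, AddSubgroup.zmultiples_neg]; exact hker
  have hτ₂t : Transcendental ℚ τ₂ := by
    rcases hτ₂ with h | h
    · rw [h]; exact hτt
    · rw [h]; intro halg; exact hτt (by simpa using halg.neg)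
  have hτ₂0 : τ₂ ≠ 0 := fun h => hτ₂t (h ▸ isAlgebraic_zero)
  -- the base isomorphism `σ₀ : ℚ^{ab}(τ) ≅ ℚ^{ab}(τ₂)`
  obtain ⟨σ₀, hσ₀, hσ₀τ⟩ := exists_isEBaseIso₂_of_expKernel hker hτt hker₂ hτ₂t
  have hle : fieldOf (Submodule.span ℚ ({τ} : Set F)) ≤ F₀ := by
    change IntermediateField.adjoin ℚ (gens (Submodule.span ℚ ({τ} : Set F))) ≤ F₀
    rw [IntermediateField.adjoin_le_iff]
    rintro z (hz | ⟨y, hy, rfl⟩)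
    · exact hDF₀ (hKD hz)
    · exact hexpF₀ y (hKD hy)
  -- `σ` is `σ₀` on `ℚ^{ab}(τ)`
  have hσSK : ∀ k : fieldOf (Submodule.span ℚ ({τ} : Set F)), σF k = σ₀ k := by
    let f₁ : fieldOf (Submodule.span ℚ ({τ} : Set F)) →+* F :=
      (algebraMap F₀ F).comp (σ.toRingHom.comp (IntermediateField.inclusion hle).toRingHom)
    let f₂ : fieldOf (Submodule.span ℚ ({τ} : Set F)) →+* F :=
      (algebraMap (fieldOf (Submodule.span ℚ ({τ₂} : Set F))) F).comp σ₀.toRingHom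
    have hf₁ : ∀ k, f₁ k = σF k := fun k => (hσF ⟨k, hle k.2⟩).symm
    have hf₂ : ∀ k, f₂ k = σ₀ k := fun k => rfl
    -- both are `q τ ↦ q τ₂`, `exp (q τ) ↦ exp (q τ₂)` on generators
    have hlin₁ : ∀ (q : ℚ), σF (q • τ) = q • τ₂ := fun q => by rw [hσFsmul q τ hτF₀]
    have hlin₂ : ∀ (q : ℚ) (h : q • τ ∈ fieldOf (Submodule.span ℚ ({τ} : Set F))),
        ((σ₀ ⟨q • τ, h⟩ : fieldOf (Submodule.span ℚ ({τ₂} : Set F))) : F) = q • τ₂ := by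
      intro q h
      have e : (⟨q • τ, h⟩ : fieldOf (Submodule.span ℚ ({τ} : Set F))) =
          q • ⟨τ, mem_fieldOf_of_mem (Submodule.subset_span rfl)⟩ := Subtype.ext rfl
      rw [e, map_rat_smul]
      push_cast
      rw [hσ₀τ]
    have hgen : ∀ x (hx : x ∈ gens (Submodule.span ℚ ({τ} : Set F))),
        f₁ ⟨x, gens_subset_fieldOf _ hx⟩ = f₂ ⟨x, gens_subset_fieldOf _ hx⟩ := by
      intro x hx
      rw [hf₁, hf₂]
      rcases hx with hx | ⟨y, hy, rfl⟩
      · obtain ⟨q, rfl⟩ := Submodule.mem_span_singleton.1 hx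
        rw [hlin₁, hlin₂]
      · obtain ⟨q, rfl⟩ := Submodule.mem_span_singleton.1 hy
        rw [hσFexp _ (hKD hy), hlin₁, hσ₀.coe_map_exp hy (mem_fieldOf_of_mem hy), hlin₂]
    have heq : f₁.toRatAlgHom = f₂.toRatAlgHom :=
      IntermediateField.algHom_ext_of_eq_adjoin (F := ℚ) rfl fun x hx => hgen x hx
    intro k
    have := DFunLike.congr_fun heq k
    rw [← hf₁, ← hf₂]
    exact this
  -- the generators: `d` enumerates `X ∩ D`, `w ⊆ X` is a basis of `ℚX` modulo `D`
  have hXsub : (X : Set F) ⊆ F₀ := by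
    rw [← hXF₀]; exact fun x hx => IntermediateField.subset_adjoin ℚ _ (Or.inl hx)
  have hDX : D ≤ Submodule.span ℚ (X : Set F) := by
    rw [← hXD]; exact Submodule.span_mono inter_subset_left
  set Xd : Finset F := X.filter (fun x => x ∈ D) with hXd
  set d : Fin Xd.card → F := fun i => (Xd.equivFin.symm i : F) with hddef
  have hranged : range d = (X : Set F) ∩ (D : Set F) := by
    ext x
    constructor
    · rintro ⟨i, rfl⟩
      have := (Xd.equivFin.symm i).2
      exact Finset.mem_filter.1 this
    · rintro ⟨hx, hxD⟩
      have hx' : x ∈ Xd := by rw [hXd, Finset.mem_filter]; exact ⟨hx, hxD⟩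
      exact ⟨Xd.equivFin ⟨x, hx'⟩, by simp [hddef]⟩
  have hdD : ∀ i, d i ∈ D := fun i => (hranged.le ⟨i, rfl⟩).2
  have hdX : ∀ i, d i ∈ X := fun i => (hranged.le ⟨i, rfl⟩).1
  have hspand : Submodule.span ℚ (range d) = D := by rw [hranged, hXD]
  set xt : Fin X.card → F := fun i => (X.equivFin.symm i : F) with hxt
  have hrangext : range xt = (X : Set F) := by
    ext x
    constructor
    · rintro ⟨i, rfl⟩; exact (X.equivFin.symm i).2
    · intro hx; exact ⟨X.equivFin ⟨x, hx⟩, by simp [hxt]⟩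
  obtain ⟨k, ρ, hw, hwspan⟩ := exists_linIndepOver_comp D xt
  set w : Fin k → F := xt ∘ ρ with hwdef
  have hwX : ∀ j, w j ∈ X := fun j => hrangext.le ⟨ρ j, rfl⟩
  set c : Fin (Xd.card + k) → F := Fin.append d w with hcdef
  have hcX : ∀ i, c i ∈ X := by
    intro i
    refine Fin.addCases (fun i₁ => ?_) (fun j => ?_) i
    · rw [hcdef, Fin.append_left]; exact hdX i₁
    · rw [hcdef, Fin.append_right]; exact hwX j
  have hcF₀ : range c ⊆ F₀ := by rintro _ ⟨i, rfl⟩; exact hXsub (hcX i)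
  have hDc : D ≤ Submodule.span ℚ (range c) := by
    rw [← hspand]
    refine Submodule.span_mono ?_
    rintro _ ⟨i, rfl⟩
    exact ⟨Fin.castAdd k i, by rw [hcdef, Fin.append_left]⟩
  have hwc : Submodule.span ℚ (range w) ≤ Submodule.span ℚ (range c) := by
    refine Submodule.span_mono ?_
    rintro _ ⟨j, rfl⟩
    exact ⟨Fin.natAdd Xd.card j, by rw [hcdef, Fin.append_right]⟩
  have hXc : (X : Set F) ⊆ Submodule.span ℚ (range c) := by
    intro x hx
    have h1 : x ∈ D ⊔ Submodule.span ℚ (range xt) := by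
      rw [hrangext]; exact Submodule.mem_sup_right (Submodule.subset_span hx)
    rw [← hwspan] at h1
    exact (sup_le hDc hwc) h1
  -- `ℚτ + ℚc = ℚX` is strong
  have hspan₁ : Submodule.span ℚ {τ} ⊔ Submodule.span ℚ (range c) = Submodule.span ℚ (X : Set F) := by
    refine le_antisymm (sup_le (hKD.trans hDX) (Submodule.span_le.2 ?_)) (Submodule.span_le.2 ?_)
    · rintro _ ⟨i, rfl⟩; exact Submodule.subset_span (hcX i)
    · exact fun x hx => Submodule.mem_sup_right (hXc hx)
  have hs : IsStrong (Submodule.span ℚ {τ} ⊔ Submodule.span ℚ (range c)) := by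
    rw [hspan₁]; exact isStrong_span_of_kmoStrong hexpF₀ hstrong hXsub hDX
  -- `ℚτ₂ + ℚσc = ℚσX` is strong
  set X₂ : Finset F := X.image σF with hX₂def
  have hX₂ : (X₂ : Set F) = σF '' (X : Set F) := by rw [hX₂def, Finset.coe_image]
  have hX₂sub : (X₂ : Set F) ⊆ F₀ := by
    rw [hX₂]; rintro _ ⟨x, hx, rfl⟩; exact hσFmem x (hXsub hx)
  have hDX₂ : D ≤ Submodule.span ℚ (X₂ : Set F) := by
    intro dd hdd
    have hy : ((σ.symm ⟨dd, hDF₀ hdd⟩ : F₀) : F) ∈ D := coe_symm_apply_mem σ hσD _ hdd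
    have h1 := sigmaF_mem_span_image σ hσF hXsub (hDX hy)
    rw [hσF, RingEquiv.apply_symm_apply] at h1
    rw [hX₂]; exact h1
  have hspan₂ : Submodule.span ℚ {τ₂} ⊔ Submodule.span ℚ (range (σF ∘ c)) =
      Submodule.span ℚ (X₂ : Set F) := by
    refine le_antisymm (sup_le ?_ (Submodule.span_le.2 ?_)) (Submodule.span_le.2 ?_)
    · rw [Submodule.span_singleton_le_iff_mem, hτ₂def, hX₂]
      exact sigmaF_mem_span_image σ hσF hXsub (hDX hτD)
    · rintro _ ⟨i, rfl⟩
      rw [hX₂]; exact Submodule.subset_span (mem_image_of_mem _ (hcX i))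
    · rw [hX₂]
      rintro _ ⟨x, hx, rfl⟩
      have := sigmaF_mem_span_image σ hσF hcF₀ (hXc hx)
      rw [← range_comp] at this
      exact Submodule.mem_sup_right this
  have hs' : IsStrong (Submodule.span ℚ {τ₂} ⊔ Submodule.span ℚ (range (σF ∘ c))) := by
    rw [hspan₂]; exact isStrong_span_of_kmoStrong hexpF₀ hstrong hX₂sub hDX₂
  -- `c ↦ σ c` is a cross Γ-isomorphism over `σ₀`
  have hdexp : ∀ (i : Fin Xd.card) (M : ℕ), exp (d i / (M.factorial : F)) ∈ F₀ ∧
      σF (exp (d i / (M.factorial : F))) = exp (σF (d i) / (M.factorial : F)) := by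
    intro i M
    have hdM : d i / (M.factorial : F) ∈ D := by
      rw [div_natCast_eq_smul]; exact Submodule.smul_mem _ _ (hdD i)
    exact ⟨hexpF₀ _ hdM, by rw [hσFexp _ hdM, hσFdiv _ M (hDF₀ (hdD i))]⟩
  have hwF₀ : ∀ j, w j ∈ F₀ := fun j => hXsub (hwX j)
  have hw'F₀ : ∀ j, (σF ∘ w) j ∈ F₀ := fun j => hσFmem _ (hwF₀ j)
  have hw' : LinIndepOver D (σF ∘ w) := by
    intro q hq
    -- `∑ qⱼ σ(wⱼ) = σ (∑ qⱼ wⱼ)`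
    have hsum : ∀ (t : Finset (Fin k)), σF (∑ j ∈ t, q j • w j) = ∑ j ∈ t, q j • σF (w j) ∧
        (∑ j ∈ t, q j • w j) ∈ F₀ := by
      intro t
      induction t using Finset.induction_on with
      | empty =>
        refine ⟨?_, by simp⟩
        simp only [Finset.sum_empty]
        have := hσF 0
        rw [map_zero] at this
        exact this
      | insert j t hj ih =>
        rw [Finset.sum_insert hj, Finset.sum_insert hj]
        have hmem : q j • w j ∈ F₀ := F₀.toSubalgebra.smul_mem (hwF₀ j) _
        refine ⟨?_, add_mem hmem ih.2⟩
        rw [hσFadd _ _ hmem ih.2, ih.1, hσFsmul _ _ (hwF₀ j)]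
    have h1 : σF (∑ j, q j • w j) ∈ D := by rw [(hsum Finset.univ).1]; exact hq
    have h2 : (∑ j, q j • w j) ∈ D := by
      have hmem := (hsum Finset.univ).2
      rw [hσF ⟨_, hmem⟩] at h1
      have := coe_symm_apply_mem σ hσD _ h1
      rwa [RingEquiv.symm_apply_apply] at this
    exact hw q h2
  have hz : ∀ M : ℕ, AlgebraicIndependent F₀ fun j => exp (w j / (M.factorial : F)) := fun M =>
    algebraicIndependent_exp_div_of_kmoStrong hstrong hwF₀ hw M
  have hz' : ∀ M : ℕ, AlgebraicIndependent F₀ fun j => exp (σF (w j) / (M.factorial : F)) := fun M =>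
    algebraicIndependent_exp_div_of_kmoStrong hstrong hw'F₀ hw' M
  have hiso : IsGammaIsoTw₂ σ₀ c (σF ∘ c) :=
    isGammaIsoTw₂_of_kmo σF hle hσSK σ.toRingHom (fun y => hσF y) σ.injective
      (fun i => hDF₀ (hdD i)) hwF₀ hdexp hz hz'
  -- the automorphism
  obtain ⟨ρ', hρc, -⟩ := hmain hker hker₂ hτ0 hτ₂0 hσ₀ hiso hs hs'
  refine ⟨ρ', ?_⟩
  -- it agrees with `σ` on `span c ⊇ X ∪ D`
  have hspancF₀ : ∀ z ∈ Submodule.span ℚ (range c), z ∈ F₀ := fun z hz =>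
    (Submodule.span_le (p := Subalgebra.toSubmodule F₀.toSubalgebra)).2 hcF₀ hz
  have hρspan : ∀ y ∈ Submodule.span ℚ (range c), ρ' y = σF y := by
    intro y hy
    induction hy using Submodule.span_induction with
    | mem x hx => obtain ⟨i, rfl⟩ := hx; exact hρc i
    | zero =>
      have := hσF 0
      rw [map_zero] at this
      rw [map_zero]; exact this.symm
    | add x y hx hy ihx ihy => rw [map_add, ihx, ihy, hσFadd _ _ (hspancF₀ x hx) (hspancF₀ y hy)]
    | smul q x hx ihx => rw [map_rat_smul, ihx, hσFsmul _ _ (hspancF₀ x hx)]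
  -- hence on the generators `X ∪ exp D` of `F₀`, hence on `F₀`
  let φ₁ : F₀ →+* F := ρ'.toRingEquiv.toRingHom.comp (algebraMap F₀ F)
  let φ₂ : F₀ →+* F := (algebraMap F₀ F).comp σ.toRingHom
  have hφ : φ₁.toRatAlgHom = φ₂.toRatAlgHom := by
    refine IntermediateField.algHom_ext_of_eq_adjoin (F := ℚ) hXF₀.symm fun x hx => ?_
    change ρ' x = ((σ ⟨x, _⟩ : F₀) : F)
    rw [← hσF]
    rcases hx with hx | ⟨dd, hdd, rfl⟩
    · exact hρspan x (hXc hx)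
    · rw [ExponentialRingEquiv.map_exp, hρspan dd (hDc hdd), hσFexp dd hdd]
  intro x
  have := DFunLike.congr_fun hφ x
  exact this

/-! ### The countable case of the Proposition -/

/-- **KMO 2012, §3.5 Proposition, for countable Zilber fields** ("In particular, the statement
holds for any countable Zilber field `F`"), in the exact rendering of
`KMO2012_automorphismExtension`: every automorphism of a finitely generated partial E-subfield
`F₀ ◁ F` containing `SK` of a countable Zilber field `F` extends to an automorphism of `F`. From
`kmo_of_gammaForm` and the countable Γ-form extension principle
`ZilberAutomorphisms.exists_equiv_of_isGammaIsoTw₂_of_countable` (Kirby 2010, Thm 2.1 /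
Prop. 2.3, proved in the tree from Bays–Kirby 2018 Lemma 8.3).
[cite: KirbyMacintyreOnshuus2012, §3.5 Proposition] [cite: Kirby2010QMEC, Thm 2.1 and Prop. 2.3] -/
theorem automorphismExtension_of_countable {F : Type u} [Field F] [CharZero F] [ExponentialRing F]
    [Countable F] (hF : IsZilberField F) (F₀ : IntermediateField ℚ F) (D : Submodule ℚ F)
    (hDF₀ : (D : Set F) ⊆ F₀) (hexpF₀ : ∀ x ∈ D, ExponentialRing.exp x ∈ F₀)
    (hkerD : ∀ x : F, ExponentialRing.exp x = 1 → x ∈ D)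
    (hfg : ∃ X : Finset F, Submodule.span ℚ ((X : Set F) ∩ (D : Set F)) = D ∧
      IntermediateField.adjoin ℚ ((X : Set F) ∪ ExponentialRing.exp '' (D : Set F)) = F₀)
    (hstrong : ∀ Y : Finset F,
      (Module.finrank ℚ ↥((Submodule.span ℚ (Y : Set F)).map D.mkQ) : Cardinal) ≤
        Algebra.trdeg F₀ ↥(IntermediateField.adjoin F₀
          ((Y : Set F) ∪ ExponentialRing.exp '' (Y : Set F))))
    (σ : F₀ ≃+* F₀) (hσD : ∀ x : F₀, (x : F) ∈ D → (σ x : F) ∈ D)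
    (hσexp : ∀ x y : F₀, (x : F) ∈ D → ExponentialRing.exp (x : F) = y →
      ExponentialRing.exp (σ x : F) = σ y) :
    ∃ σ' : ExponentialRingEquiv F F, ∀ x : F₀, σ' x = σ x :=
  kmo_of_gammaForm hF
    (fun hk₁ hk₂ h₁ h₂ _ hσ₀ _ _ _ hiso hs hs' =>
      ZilberAutomorphisms.exists_equiv_of_isGammaIsoTw₂_of_countable hF hk₁ hk₂ h₁ h₂ hσ₀ hiso hs hs')
    F₀ D hDF₀ hexpF₀ hkerD hfg hstrong σ hσD hσexp

end KMO2012

/-! ### The Proposition for all Zilber fields in `Type` -/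

/-- **KMO 2012, §3.5 Proposition: the named fact `KMO2012_automorphismExtension` HOLDS for all
Zilber fields in `Type`** (universe `0`; the fact is universe-polymorphic and this is its
instance `KMO2012_automorphismExtension.{0}`, which is the one used for `ℂ_exp`). In a Zilber
field `F : Type` (with CCP), every automorphism of a finitely generated partial E-subfield
`F₀ ◁ F` containing `SK` extends to an automorphism of the exponential field `F`. Proof: the
translation `KMO2012.kmo_of_gammaForm` and the Γ-form extension principle for Zilber fields in
`Type`, `ZilberAutomorphisms.exists_equiv_of_isGammaIsoTw₂₀` (countable `F`: Kirby 2010 Thm 2.1 /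
Prop. 2.3 by the anchored back-and-forth of `ZilberFieldAutomorphisms.lean`; uncountable `F`: hull
to closure there, and closure to the field by Kirby 2010 Thm 3.3 in the quasiminimal pregeometry
class `ZilberClosedClassOver (ecl ∅)` of the tree's proof of Zilber's categoricity theorem,
`ZilberFieldAutomorphismsUncountable.lean` / `ClassExtendClosure.lean`) — i.e. exactly the printed
proof, "quasiminimal excellence of the class of Zilber fields and Theorem 3.3 in [K3]". The
restriction to `Type` comes from the class machinery (`Language.eclIsoOver P` is indexed by pointed
E-fields in `Type`); countable Zilber fields are covered in every universe by
`KMO2012.automorphismExtension_of_countable`. [cite: KirbyMacintyreOnshuus2012, §3.5 Proposition]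
[cite: Kirby2010QMEC, Thm 2.1, Prop. 2.3 and Thm 3.3] -/
theorem KMO2012_automorphismExtension_of_type_zero : KMO2012_automorphismExtension.{0} :=
  fun _ _ _ _ hF F₀ D hDF₀ hexpF₀ hkerD hfg hstrong σ hσD hσexp =>
    KMO2012.kmo_of_gammaForm hF
      (fun hk₁ hk₂ h₁ h₂ _ hσ₀ _ _ _ hiso hs hs' =>
        ZilberAutomorphisms.exists_equiv_of_isGammaIsoTw₂₀ hF hk₁ hk₂ h₁ h₂ hσ₀ hiso hs hs')
      F₀ D hDF₀ hexpF₀ hkerD hfg hstrong σ hσD hσexp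

end Literature.ModelTheory.ExponentialFields
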